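import Mathlib
import HarnessLib
import Summits.AtomisticToContinuum.FouriersLaw.Theses.JunctionLocality
import Summits.AtomisticToContinuum.FouriersLaw.Theorems.JunctionLocalityConductanceLowerBoundContactCertificateAlgebra

/-!
# Contact formation, Ib: `X_H F_i`, the curl identity, and the test function `φ = p_0 F_1 − p_1 F_0`

Helper file (`--supports` stmt-AtomisticToContinuum-11749) for stub `stub_contactFormation` (R4) of the line
`cold-bath-relocation-walk` of the crux `JunctionLocality.ConductanceLowerBound` (lead c2 worker); continuation of
`…ContactCertificateAlgebra` (pointwise algebra only, no measure theory).

With the contact forces `F_0 = −U'(q_0) + V'(q_1 − q_0)`, `F_1 = −U'(q_1) − V'(q_1 − q_0) + εV'(q_{j₂} − q_1)` of the pinned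
chain (`…ContactCertificateAlgebra`), `X_H = liouvilleOp`, `S_i = thermo L i T`:

* `∂_{q_j} F_0`, `∂_{q_j} F_1`, `X_H F_0`, `X_H F_1` in closed form and the CURL IDENTITY
  `∂_{q_1}F_0 = ∂_{q_0}F_1 = V''(q_1 − q_0)`, whence `∂_{p_1} A_1 = ∂_{p_0} A_0 = V''(q_1 − q_0)` for `A_0 = γF_1 + X_H F_1`,
  `A_1 = γF_0 + X_H F_0`;
* `φ = p_0F_1 − p_1F_0`: `∂_{p_0}φ = F_1`, `∂_{p_1}φ = −F_0`, `(S_0 + S_1)φ = −φ`, `X_H φ = p_0 X_H F_1 − p_1 X_H F_0`, so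
  `−X_H φ + γ S_{𝟙_0+𝟙_1} φ = −(p_0A_0 − p_1A_1)` (registered helper `contact_testFunction_backward`); `φ` is odd under
  momentum reversal; `S_{𝟙_0+𝟙_1} = S_0 + S_1` (`contact_bathOp_two`).

References: folklore.
-/

noncomputable section

open MeasureTheory Filter Topology
open scoped ContDiff
open Literature.MathematicalPhysics.KineticTheory.HeatConduction
open Summit.AtomisticToContinuum.FouriersLaw.Theorems.SuperadditiveResistance.DeviceLiouville
  (kin thermo liouvilleOp bathOp thermo_eq kin_eq_sq partialP_mul partialQ_mul partialP_sub partialQ_sub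
    liouvilleOp_sub)
open Summit.AtomisticToContinuum.FouriersLaw.Theorems.SuperadditiveResistance.Kubo (liouvilleOp_mul)

namespace Summit.AtomisticToContinuum.FouriersLaw.Cruxes.ConductanceLowerBound.ColdBathRelocationWalk

/-! ## Coordinate derivatives of the forces, `X_H F_0`, `X_H F_1` and the curl identity -/

section ForceCalculus

variable {ω₂ lam β γ : ℝ} {L : ℕ} {i0 i1 j2 : Fin L} {ε : ℝ} {F0 F1 : PhaseSpace L → ℝ}

/-- `∂_{q_j} F_0 = −[j=0] U''(q_0) + V''(q_1 − q_0)([j=1] − [j=0])`. [folklore] -/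
theorem contact_partialQ_F0
    (hF0 : F0 = fun y => -deriv (pinnedChain ω₂ lam β γ).U (y.1 i0) +
      deriv (pinnedChain ω₂ lam β γ).V (y.1 i1 - y.1 i0)) (j : Fin L) (x : PhaseSpace L) :
    partialQ j F0 x = -(if i0 = j then deriv (deriv (pinnedChain ω₂ lam β γ).U) (x.1 i0) else 0) +
      deriv (deriv (pinnedChain ω₂ lam β γ).V) (x.1 i1 - x.1 i0) *
        ((if i1 = j then 1 else 0) - (if i0 = j then 1 else 0)) := by
  have hU : Differentiable ℝ (deriv (pinnedChain ω₂ lam β γ).U) :=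
    (contact_contDiff_dU ω₂ lam β γ (n := 1)).differentiable one_ne_zero
  have hV : Differentiable ℝ (deriv (pinnedChain ω₂ lam β γ).V) :=
    (contact_contDiff_dV ω₂ lam β γ (n := 1)).differentiable one_ne_zero
  have h1 : Differentiable ℝ fun y : PhaseSpace L => -deriv (pinnedChain ω₂ lam β γ).U (y.1 i0) := by fun_prop
  have h2 : Differentiable ℝ fun y : PhaseSpace L => deriv (pinnedChain ω₂ lam β γ).V (y.1 i1 - y.1 i0) := by
    fun_prop
  rw [hF0, contact_partialQ_add h1 h2, contact_partialQ_neg, contact_partialQ_comp_fst, contact_partialQ_comp_sub]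

/-- `∂_{q_j} F_1 = −[j=1] U''(q_1) − V''(q_1 − q_0)([j=1] − [j=0]) + ε V''(q_{j₂} − q_1)([j=j₂] − [j=1])`. [folklore] -/
theorem contact_partialQ_F1
    (hF1 : F1 = fun y => -deriv (pinnedChain ω₂ lam β γ).U (y.1 i1) -
      deriv (pinnedChain ω₂ lam β γ).V (y.1 i1 - y.1 i0) + ε * deriv (pinnedChain ω₂ lam β γ).V (y.1 j2 - y.1 i1))
    (j : Fin L) (x : PhaseSpace L) :
    partialQ j F1 x = -(if i1 = j then deriv (deriv (pinnedChain ω₂ lam β γ).U) (x.1 i1) else 0) -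
      deriv (deriv (pinnedChain ω₂ lam β γ).V) (x.1 i1 - x.1 i0) *
        ((if i1 = j then 1 else 0) - (if i0 = j then 1 else 0)) +
      ε * (deriv (deriv (pinnedChain ω₂ lam β γ).V) (x.1 j2 - x.1 i1) *
        ((if j2 = j then 1 else 0) - (if i1 = j then 1 else 0))) := by
  have hU : Differentiable ℝ (deriv (pinnedChain ω₂ lam β γ).U) :=
    (contact_contDiff_dU ω₂ lam β γ (n := 1)).differentiable one_ne_zero
  have hV : Differentiable ℝ (deriv (pinnedChain ω₂ lam β γ).V) :=
    (contact_contDiff_dV ω₂ lam β γ (n := 1)).differentiable one_ne_zero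
  have h1 : Differentiable ℝ fun y : PhaseSpace L => -deriv (pinnedChain ω₂ lam β γ).U (y.1 i1) := by fun_prop
  have h2 : Differentiable ℝ fun y : PhaseSpace L => deriv (pinnedChain ω₂ lam β γ).V (y.1 i1 - y.1 i0) := by
    fun_prop
  have h12 : Differentiable ℝ fun y : PhaseSpace L => -deriv (pinnedChain ω₂ lam β γ).U (y.1 i1) -
      deriv (pinnedChain ω₂ lam β γ).V (y.1 i1 - y.1 i0) := by fun_prop
  have h3 : Differentiable ℝ fun y : PhaseSpace L =>
      ε * deriv (pinnedChain ω₂ lam β γ).V (y.1 j2 - y.1 i1) := by fun_prop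
  rw [hF1, contact_partialQ_add h12 h3, partialQ_sub h1 h2, contact_partialQ_neg, contact_partialQ_const_mul,
    contact_partialQ_comp_fst, contact_partialQ_comp_sub, contact_partialQ_comp_sub]

/-- `X_H F_0 = −U''(q_0) p_0 + V''(q_1 − q_0)(p_1 − p_0)`. [folklore] -/
theorem contact_liouvilleOp_F0
    (hF0 : F0 = fun y => -deriv (pinnedChain ω₂ lam β γ).U (y.1 i0) +
      deriv (pinnedChain ω₂ lam β γ).V (y.1 i1 - y.1 i0)) (x : PhaseSpace L) :
    liouvilleOp (pinnedChain ω₂ lam β γ) L F0 x =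
      -deriv (deriv (pinnedChain ω₂ lam β γ).U) (x.1 i0) * x.2 i0 +
        deriv (deriv (pinnedChain ω₂ lam β γ).V) (x.1 i1 - x.1 i0) * (x.2 i1 - x.2 i0) := by
  rw [contact_liouvilleOp_of_partialP_eq_zero _ (contact_partialP_F0 hF0)]
  simp_rw [contact_partialQ_F0 hF0]
  have key : ∀ j : Fin L, x.2 j * (-(if i0 = j then deriv (deriv (pinnedChain ω₂ lam β γ).U) (x.1 i0) else 0) +
      deriv (deriv (pinnedChain ω₂ lam β γ).V) (x.1 i1 - x.1 i0) * ((if i1 = j then 1 else 0) - (if i0 = j then 1 else 0))) =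
      -deriv (deriv (pinnedChain ω₂ lam β γ).U) (x.1 i0) * (x.2 j * (if i0 = j then 1 else 0)) +
        deriv (deriv (pinnedChain ω₂ lam β γ).V) (x.1 i1 - x.1 i0) * (x.2 j * (if i1 = j then 1 else 0)) -
        deriv (deriv (pinnedChain ω₂ lam β γ).V) (x.1 i1 - x.1 i0) * (x.2 j * (if i0 = j then 1 else 0)) := by
    intro j
    split_ifs <;> ring
  rw [Finset.sum_congr rfl fun j _ => key j, Finset.sum_sub_distrib, Finset.sum_add_distrib, ← Finset.mul_sum,
    ← Finset.mul_sum, ← Finset.mul_sum, contact_sum_mul_ite, contact_sum_mul_ite]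
  ring

/-- `X_H F_1 = −U''(q_1) p_1 − V''(q_1 − q_0)(p_1 − p_0) + ε V''(q_{j₂} − q_1)(p_{j₂} − p_1)`. [folklore] -/
theorem contact_liouvilleOp_F1
    (hF1 : F1 = fun y => -deriv (pinnedChain ω₂ lam β γ).U (y.1 i1) -
      deriv (pinnedChain ω₂ lam β γ).V (y.1 i1 - y.1 i0) + ε * deriv (pinnedChain ω₂ lam β γ).V (y.1 j2 - y.1 i1))
    (x : PhaseSpace L) :
    liouvilleOp (pinnedChain ω₂ lam β γ) L F1 x =
      -deriv (deriv (pinnedChain ω₂ lam β γ).U) (x.1 i1) * x.2 i1 -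
        deriv (deriv (pinnedChain ω₂ lam β γ).V) (x.1 i1 - x.1 i0) * (x.2 i1 - x.2 i0) +
        ε * (deriv (deriv (pinnedChain ω₂ lam β γ).V) (x.1 j2 - x.1 i1) * (x.2 j2 - x.2 i1)) := by
  rw [contact_liouvilleOp_of_partialP_eq_zero _ (contact_partialP_F1 hF1)]
  simp_rw [contact_partialQ_F1 hF1]
  have key : ∀ j : Fin L, x.2 j * (-(if i1 = j then deriv (deriv (pinnedChain ω₂ lam β γ).U) (x.1 i1) else 0) -
      deriv (deriv (pinnedChain ω₂ lam β γ).V) (x.1 i1 - x.1 i0) * ((if i1 = j then 1 else 0) - (if i0 = j then 1 else 0)) +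
      ε * (deriv (deriv (pinnedChain ω₂ lam β γ).V) (x.1 j2 - x.1 i1) *
        ((if j2 = j then 1 else 0) - (if i1 = j then 1 else 0)))) =
      -deriv (deriv (pinnedChain ω₂ lam β γ).U) (x.1 i1) * (x.2 j * (if i1 = j then 1 else 0)) -
        deriv (deriv (pinnedChain ω₂ lam β γ).V) (x.1 i1 - x.1 i0) * (x.2 j * (if i1 = j then 1 else 0)) +
        deriv (deriv (pinnedChain ω₂ lam β γ).V) (x.1 i1 - x.1 i0) * (x.2 j * (if i0 = j then 1 else 0)) +
        ε * deriv (deriv (pinnedChain ω₂ lam β γ).V) (x.1 j2 - x.1 i1) * (x.2 j * (if j2 = j then 1 else 0)) -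
        ε * deriv (deriv (pinnedChain ω₂ lam β γ).V) (x.1 j2 - x.1 i1) * (x.2 j * (if i1 = j then 1 else 0)) := by
    intro j
    split_ifs <;> ring
  rw [Finset.sum_congr rfl fun j _ => key j, Finset.sum_sub_distrib, Finset.sum_add_distrib, Finset.sum_add_distrib,
    Finset.sum_sub_distrib, ← Finset.mul_sum, ← Finset.mul_sum, ← Finset.mul_sum, ← Finset.mul_sum, ← Finset.mul_sum,
    contact_sum_mul_ite, contact_sum_mul_ite, contact_sum_mul_ite]
  ring

/-- **Curl identity, first half**: `∂_{q_1} F_0 = V''(q_1 − q_0)`. [folklore] -/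
theorem contact_partialQ_one_F0 (h01 : i0 ≠ i1)
    (hF0 : F0 = fun y => -deriv (pinnedChain ω₂ lam β γ).U (y.1 i0) +
      deriv (pinnedChain ω₂ lam β γ).V (y.1 i1 - y.1 i0)) (x : PhaseSpace L) :
    partialQ i1 F0 x = deriv (deriv (pinnedChain ω₂ lam β γ).V) (x.1 i1 - x.1 i0) := by
  rw [contact_partialQ_F0 hF0]
  simp [h01]

/-- **Curl identity, second half**: `∂_{q_0} F_1 = V''(q_1 − q_0)` (`j₂ ≠ 0`). [folklore] -/
theorem contact_partialQ_zero_F1 (h01 : i0 ≠ i1) (hj2 : j2 ≠ i0)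
    (hF1 : F1 = fun y => -deriv (pinnedChain ω₂ lam β γ).U (y.1 i1) -
      deriv (pinnedChain ω₂ lam β γ).V (y.1 i1 - y.1 i0) + ε * deriv (pinnedChain ω₂ lam β γ).V (y.1 j2 - y.1 i1))
    (x : PhaseSpace L) :
    partialQ i0 F1 x = deriv (deriv (pinnedChain ω₂ lam β γ).V) (x.1 i1 - x.1 i0) := by
  rw [contact_partialQ_F1 hF1]
  simp [h01.symm, hj2]

end ForceCalculus

/-! ## The coefficients `A_0 = γF_1 + X_H F_1`, `A_1 = γF_0 + X_H F_0` and the test function `φ` -/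

section TestFunction

variable {ω₂ lam β γ : ℝ} {L : ℕ} {i0 i1 j2 : Fin L} {ε : ℝ} {F0 F1 : PhaseSpace L → ℝ}

/-- `∂_{p_1} A_1 = ∂_{q_1} F_0 = V''(q_1 − q_0)` for `A_1 = γF_0 + X_H F_0`. [folklore] -/
theorem contact_partialP_one_A1 (h01 : i0 ≠ i1)
    (hF0 : F0 = fun y => -deriv (pinnedChain ω₂ lam β γ).U (y.1 i0) +
      deriv (pinnedChain ω₂ lam β γ).V (y.1 i1 - y.1 i0)) (x : PhaseSpace L) :
    partialP i1 (fun y => γ * F0 y + liouvilleOp (pinnedChain ω₂ lam β γ) L F0 y) x =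
      deriv (deriv (pinnedChain ω₂ lam β γ).V) (x.1 i1 - x.1 i0) := by
  have hX : liouvilleOp (pinnedChain ω₂ lam β γ) L F0 = fun y =>
      -deriv (deriv (pinnedChain ω₂ lam β γ).U) (y.1 i0) * y.2 i0 +
        deriv (deriv (pinnedChain ω₂ lam β γ).V) (y.1 i1 - y.1 i0) * (y.2 i1 - y.2 i0) :=
    funext (contact_liouvilleOp_F0 hF0)
  rw [hX, hF0]
  unfold partialP
  simp only [Function.update_self, Function.update_of_ne h01]
  have hd : HasDerivAt (fun t : ℝ => γ * (-deriv (pinnedChain ω₂ lam β γ).U (x.1 i0) +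
      deriv (pinnedChain ω₂ lam β γ).V (x.1 i1 - x.1 i0)) +
      (-deriv (deriv (pinnedChain ω₂ lam β γ).U) (x.1 i0) * x.2 i0 +
        deriv (deriv (pinnedChain ω₂ lam β γ).V) (x.1 i1 - x.1 i0) * (t - x.2 i0)))
      (0 + (0 + deriv (deriv (pinnedChain ω₂ lam β γ).V) (x.1 i1 - x.1 i0) * (1 - 0))) (x.2 i1) :=
    (hasDerivAt_const _ _).add ((hasDerivAt_const _ _).add
      (((hasDerivAt_id _).sub (hasDerivAt_const _ _)).const_mul _))
  rw [hd.deriv]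
  ring

/-- `∂_{p_0} A_0 = ∂_{q_0} F_1 = V''(q_1 − q_0)` for `A_0 = γF_1 + X_H F_1` (`j₂ ≠ 0`). [folklore] -/
theorem contact_partialP_zero_A0 (h01 : i0 ≠ i1) (hj2 : j2 ≠ i0)
    (hF1 : F1 = fun y => -deriv (pinnedChain ω₂ lam β γ).U (y.1 i1) -
      deriv (pinnedChain ω₂ lam β γ).V (y.1 i1 - y.1 i0) + ε * deriv (pinnedChain ω₂ lam β γ).V (y.1 j2 - y.1 i1))
    (x : PhaseSpace L) :
    partialP i0 (fun y => γ * F1 y + liouvilleOp (pinnedChain ω₂ lam β γ) L F1 y) x =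
      deriv (deriv (pinnedChain ω₂ lam β γ).V) (x.1 i1 - x.1 i0) := by
  have hX : liouvilleOp (pinnedChain ω₂ lam β γ) L F1 = fun y =>
      -deriv (deriv (pinnedChain ω₂ lam β γ).U) (y.1 i1) * y.2 i1 -
        deriv (deriv (pinnedChain ω₂ lam β γ).V) (y.1 i1 - y.1 i0) * (y.2 i1 - y.2 i0) +
        ε * (deriv (deriv (pinnedChain ω₂ lam β γ).V) (y.1 j2 - y.1 i1) * (y.2 j2 - y.2 i1)) :=
    funext (contact_liouvilleOp_F1 hF1)
  rw [hX, hF1]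
  unfold partialP
  simp only [Function.update_self, Function.update_of_ne h01.symm, Function.update_of_ne hj2]
  have hd : HasDerivAt (fun t : ℝ => γ * (-deriv (pinnedChain ω₂ lam β γ).U (x.1 i1) -
      deriv (pinnedChain ω₂ lam β γ).V (x.1 i1 - x.1 i0) + ε * deriv (pinnedChain ω₂ lam β γ).V (x.1 j2 - x.1 i1)) +
      (-deriv (deriv (pinnedChain ω₂ lam β γ).U) (x.1 i1) * x.2 i1 -
        deriv (deriv (pinnedChain ω₂ lam β γ).V) (x.1 i1 - x.1 i0) * (x.2 i1 - t) +
        ε * (deriv (deriv (pinnedChain ω₂ lam β γ).V) (x.1 j2 - x.1 i1) * (x.2 j2 - x.2 i1))))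
      (0 + (0 - deriv (deriv (pinnedChain ω₂ lam β γ).V) (x.1 i1 - x.1 i0) * (0 - 1) + 0)) (x.2 i0) :=
    (hasDerivAt_const _ _).add (((hasDerivAt_const _ _).sub
      (((hasDerivAt_const _ _).sub (hasDerivAt_id _)).const_mul _)).add (hasDerivAt_const _ _))
  rw [hd.deriv]
  ring

/-- `∂_{p_0} φ = F_1` for `φ = p_0 F_1 − p_1 F_0`. [folklore] -/
theorem contact_partialP_zero_phi (h01 : i0 ≠ i1)
    (hF0 : F0 = fun y => -deriv (pinnedChain ω₂ lam β γ).U (y.1 i0) +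
      deriv (pinnedChain ω₂ lam β γ).V (y.1 i1 - y.1 i0))
    (hF1 : F1 = fun y => -deriv (pinnedChain ω₂ lam β γ).U (y.1 i1) -
      deriv (pinnedChain ω₂ lam β γ).V (y.1 i1 - y.1 i0) + ε * deriv (pinnedChain ω₂ lam β γ).V (y.1 j2 - y.1 i1)) :
    partialP i0 (fun y => y.2 i0 * F1 y - y.2 i1 * F0 y) = F1 := by
  have hF0d : Differentiable ℝ F0 := (contact_contDiff_F0 (n := 1) hF0).differentiable one_ne_zero
  have hF1d : Differentiable ℝ F1 := (contact_contDiff_F1 (n := 1) hF1).differentiable one_ne_zero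
  have hp0 : Differentiable ℝ fun y : PhaseSpace L => y.2 i0 := (contact_contDiff_snd (n := 1) i0).differentiable one_ne_zero
  have hp1 : Differentiable ℝ fun y : PhaseSpace L => y.2 i1 := (contact_contDiff_snd (n := 1) i1).differentiable one_ne_zero
  have hm1 : Differentiable ℝ fun y : PhaseSpace L => y.2 i0 * F1 y := hp0.mul hF1d
  have hm0 : Differentiable ℝ fun y : PhaseSpace L => y.2 i1 * F0 y := hp1.mul hF0d
  funext x
  rw [partialP_sub hm1 hm0, partialP_mul hp0 hF1d, partialP_mul hp1 hF0d, contact_partialP_snd,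
    contact_partialP_snd, contact_partialP_F0 hF0, contact_partialP_F1 hF1]
  simp [h01.symm]

/-- `∂_{p_1} φ = −F_0` for `φ = p_0 F_1 − p_1 F_0`. [folklore] -/
theorem contact_partialP_one_phi (h01 : i0 ≠ i1)
    (hF0 : F0 = fun y => -deriv (pinnedChain ω₂ lam β γ).U (y.1 i0) +
      deriv (pinnedChain ω₂ lam β γ).V (y.1 i1 - y.1 i0))
    (hF1 : F1 = fun y => -deriv (pinnedChain ω₂ lam β γ).U (y.1 i1) -
      deriv (pinnedChain ω₂ lam β γ).V (y.1 i1 - y.1 i0) + ε * deriv (pinnedChain ω₂ lam β γ).V (y.1 j2 - y.1 i1)) :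
    partialP i1 (fun y => y.2 i0 * F1 y - y.2 i1 * F0 y) = fun y => -F0 y := by
  have hF0d : Differentiable ℝ F0 := (contact_contDiff_F0 (n := 1) hF0).differentiable one_ne_zero
  have hF1d : Differentiable ℝ F1 := (contact_contDiff_F1 (n := 1) hF1).differentiable one_ne_zero
  have hp0 : Differentiable ℝ fun y : PhaseSpace L => y.2 i0 := (contact_contDiff_snd (n := 1) i0).differentiable one_ne_zero
  have hp1 : Differentiable ℝ fun y : PhaseSpace L => y.2 i1 := (contact_contDiff_snd (n := 1) i1).differentiable one_ne_zero
  have hm1 : Differentiable ℝ fun y : PhaseSpace L => y.2 i0 * F1 y := hp0.mul hF1d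
  have hm0 : Differentiable ℝ fun y : PhaseSpace L => y.2 i1 * F0 y := hp1.mul hF0d
  funext x
  rw [partialP_sub hm1 hm0, partialP_mul hp0 hF1d, partialP_mul hp1 hF0d, contact_partialP_snd,
    contact_partialP_snd, contact_partialP_F0 hF0, contact_partialP_F1 hF1]
  simp [h01]

/-- **The two thermostats act on `φ` as `−1`**: `(S_0 + S_1) φ = −φ` (`∂_{p_0}φ = F_1`, `∂_{p_1}φ = −F_0`,
`∂²_{p_0}φ = ∂²_{p_1}φ = 0`). [folklore] -/
theorem contact_thermo_phi (hi0 : i0.val = 0) (hi1 : i1.val = 1)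
    (hF0 : F0 = fun y => -deriv (pinnedChain ω₂ lam β γ).U (y.1 i0) +
      deriv (pinnedChain ω₂ lam β γ).V (y.1 i1 - y.1 i0))
    (hF1 : F1 = fun y => -deriv (pinnedChain ω₂ lam β γ).U (y.1 i1) -
      deriv (pinnedChain ω₂ lam β γ).V (y.1 i1 - y.1 i0) + ε * deriv (pinnedChain ω₂ lam β γ).V (y.1 j2 - y.1 i1))
    (T : ℝ) (x : PhaseSpace L) :
    thermo L 0 T (fun y => y.2 i0 * F1 y - y.2 i1 * F0 y) x + thermo L 1 T (fun y => y.2 i0 * F1 y - y.2 i1 * F0 y) x =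
      -(x.2 i0 * F1 x - x.2 i1 * F0 x) := by
  have h0 : 0 < L := by have := i0.isLt; omega
  have h1 : 1 < L := by have := i1.isLt; omega
  have h01 : i0 ≠ i1 := fun h => by have := congrArg Fin.val h; omega
  have e0 : (⟨0, h0⟩ : Fin L) = i0 := Fin.ext hi0.symm
  have e1 : (⟨1, h1⟩ : Fin L) = i1 := Fin.ext hi1.symm
  rw [thermo_eq h0, thermo_eq h1, e0, e1, contact_partialP_zero_phi h01 hF0 hF1, contact_partialP_one_phi h01 hF0 hF1,
    contact_partialP_F1 hF1, contact_partialP_neg, contact_partialP_F0 hF0]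
  ring

/-- **`X_H φ = p_0 X_H F_1 − p_1 X_H F_0`** for `φ = p_0 F_1 − p_1 F_0` with `F_i = −∂_{q_i}H` (Leibniz: `X_H p_i = F_i`,
the `F_0F_1` terms cancel). [folklore] -/
theorem contact_liouvilleOp_phi
    (hF0 : F0 = fun y => -deriv (pinnedChain ω₂ lam β γ).U (y.1 i0) +
      deriv (pinnedChain ω₂ lam β γ).V (y.1 i1 - y.1 i0))
    (hF1 : F1 = fun y => -deriv (pinnedChain ω₂ lam β γ).U (y.1 i1) -
      deriv (pinnedChain ω₂ lam β γ).V (y.1 i1 - y.1 i0) + ε * deriv (pinnedChain ω₂ lam β γ).V (y.1 j2 - y.1 i1))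
    (hF0H : ∀ x, F0 x = -partialQ i0 ((pinnedChain ω₂ lam β γ).hamiltonian L) x)
    (hF1H : ∀ x, F1 x = -partialQ i1 ((pinnedChain ω₂ lam β γ).hamiltonian L) x) (x : PhaseSpace L) :
    liouvilleOp (pinnedChain ω₂ lam β γ) L (fun y => y.2 i0 * F1 y - y.2 i1 * F0 y) x =
      x.2 i0 * liouvilleOp (pinnedChain ω₂ lam β γ) L F1 x - x.2 i1 * liouvilleOp (pinnedChain ω₂ lam β γ) L F0 x := by
  have hF0d : Differentiable ℝ F0 := (contact_contDiff_F0 (n := 1) hF0).differentiable one_ne_zero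
  have hF1d : Differentiable ℝ F1 := (contact_contDiff_F1 (n := 1) hF1).differentiable one_ne_zero
  have hp0 : Differentiable ℝ fun y : PhaseSpace L => y.2 i0 := (contact_contDiff_snd (n := 1) i0).differentiable one_ne_zero
  have hp1 : Differentiable ℝ fun y : PhaseSpace L => y.2 i1 := (contact_contDiff_snd (n := 1) i1).differentiable one_ne_zero
  have hm1 : Differentiable ℝ fun y : PhaseSpace L => y.2 i0 * F1 y := hp0.mul hF1d
  have hm0 : Differentiable ℝ fun y : PhaseSpace L => y.2 i1 * F0 y := hp1.mul hF0d
  rw [liouvilleOp_sub hm1 hm0, liouvilleOp_mul _ hp0 hF1d, liouvilleOp_mul _ hp1 hF0d,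
    contact_liouvilleOp_snd, contact_liouvilleOp_snd, ← hF0H, ← hF1H]
  ring

/-- The two contact thermostats as a weighted bath operator: `S_{𝟙_0 + 𝟙_1} = S_0 + S_1`
(`bathOp` with weights `[i=0] + [i=1]` is `thermo L 0 T + thermo L 1 T`). [folklore] -/
theorem contact_bathOp_two (L : ℕ) (T : ℝ) (f : PhaseSpace L → ℝ) (x : PhaseSpace L) :
    bathOp L (fun i => (if i.val = 0 then 1 else 0) + (if i.val = 1 then 1 else 0)) T f x =
      thermo L 0 T f x + thermo L 1 T f x := by
  -- adapted from the line skeleton's `bathOp_relocWeight` (m = 1)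
  unfold bathOp thermo
  rw [← Finset.sum_add_distrib]
  refine Finset.sum_congr rfl fun i _ => ?_
  dsimp only
  split_ifs <;> ring

/-- **`φ` is odd under momentum reversal** (and `p_0² − T` is even), so `⟨φ, p_0² − T⟩_{μ_T} = 0`. [folklore] -/
theorem contact_phi_neg_momentum
    (hF0 : F0 = fun y => -deriv (pinnedChain ω₂ lam β γ).U (y.1 i0) +
      deriv (pinnedChain ω₂ lam β γ).V (y.1 i1 - y.1 i0))
    (hF1 : F1 = fun y => -deriv (pinnedChain ω₂ lam β γ).U (y.1 i1) -
      deriv (pinnedChain ω₂ lam β γ).V (y.1 i1 - y.1 i0) + ε * deriv (pinnedChain ω₂ lam β γ).V (y.1 j2 - y.1 i1))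
    (x : PhaseSpace L) :
    (fun y : PhaseSpace L => y.2 i0 * F1 y - y.2 i1 * F0 y) (x.1, -x.2) = -(x.2 i0 * F1 x - x.2 i1 * F0 x) := by
  obtain ⟨e0, e1⟩ := contact_F_neg_momentum hF0 hF1 x
  simp only [e0, e1, Pi.neg_apply]
  ring

/-- **Registered helper `contact_testFunction_backward` (R4, line `cold-bath-relocation-walk`): `φ = p_0F_1 − p_1F_0` IS A
BACKWARD SOLUTION.**  For the pinned chain on `L` sites with contact sites `i0 = 0 ≠ i1 = 1`, a third site `j₂ ≠ 0`, `ε ∈ ℝ`,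
and the forces `F_0 = −U'(q_0) + V'(q_1 − q_0) = −∂_{q_0}H`, `F_1 = −U'(q_1) − V'(q_1−q_0) + εV'(q_{j₂} − q_1) = −∂_{q_1}H`:
`−X_H φ + γ S_{𝟙_0+𝟙_1} φ = −(p_0 A_0 − p_1 A_1)` pointwise, `A_0 = γF_1 + X_H F_1`, `A_1 = γF_0 + X_H F_0` — the backward
pair that the cutoff-removed cross identity `integral_cross_eq` pairs with the relocated forward field. [folklore] -/
theorem contact_testFunction_backward : ∀ {ω₂ lam β γ : ℝ} {L : ℕ} {i0 i1 j2 : Fin L} {ε : ℝ} {F0 F1 : PhaseSpace L → ℝ}, i0.val = 0 → i1.val = 1 → (F0 = fun y => -deriv (pinnedChain ω₂ lam β γ).U (y.1 i0) + deriv (pinnedChain ω₂ lam β γ).V (y.1 i1 - y.1 i0)) → (F1 = fun y => -deriv (pinnedChain ω₂ lam β γ).U (y.1 i1) - deriv (pinnedChain ω₂ lam β γ).V (y.1 i1 - y.1 i0) + ε * deriv (pinnedChain ω₂ lam β γ).V (y.1 j2 - y.1 i1)) → (∀ x, F0 x = -partialQ i0 ((pinnedChain ω₂ lam β γ).hamiltonian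 L) x) → (∀ x, F1 x = -partialQ i1 ((pinnedChain ω₂ lam β γ).hamiltonian L) x) → ∀ (T : ℝ) (x : PhaseSpace L), -1 * liouvilleOp (pinnedChain ω₂ lam β γ) L (fun y => y.2 i0 * F1 y - y.2 i1 * F0 y) x + γ * bathOp L (fun i => (if i.val = 0 then 1 else 0) + (if i.val = 1 then 1 else 0)) T (fun y => y.2 i0 * F1 y - y.2 i1 * F0 y) x = -(x.2 i0 * (γ * F1 x + liouvilleOp (pinnedChain ω₂ lam β γ) L F1 x) - x.2 i1 * (γ * F0 x + liouvilleOp (pinnedChain ω₂ lam β γ) L F0 x)) := by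
  intro ω₂ lam β γ L i0 i1 j2 ε F0 F1 hi0 hi1 hF0 hF1 hF0H hF1H T x
  rw [contact_bathOp_two, contact_thermo_phi hi0 hi1 hF0 hF1, contact_liouvilleOp_phi hF0 hF1 hF0H hF1H]
  ring

end TestFunction

end Summit.AtomisticToContinuum.FouriersLaw.Cruxes.ConductanceLowerBound.ColdBathRelocationWalk

end
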